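import Mathlib.Probability.Distributions.Uniform
import Mathlib.Data.Fintype.Vector
import Literature.Computability.Complexity.TimeBounds
import Literature.Computability.Complexity.BoolEncodings
import HarnessLib

-- provenance: harness21/H21/H21/Prelude/CplxCore/Randomized.lean @ 4a16de1 (interim HEAD d8f2665); M5 mechanical rewrite
/-!
# Complexity core: randomized algorithms

Trunk `CplxCore`, concept C7 (`Randomized`; realises the notion `ppt_machine`).

A randomized (probabilistic) algorithm is modelled as a *deterministic* function of the pair
(input, coin string): `RandAlg α β` bundles `run : α → List Bool → β` with a coin budget
`coinLen : ℕ → ℕ` (number of coins as a function of the encoded input length). Its output law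
on input `x` is the push-forward of the uniform distribution on `{0,1}^{coinLen |x|}`, a Mathlib
`PMF β` (`RandAlg.outputPMF`); probabilities of events are `RandAlg.pr`. Polynomial time
(`RandAlg.IsPolyTime`) is `PolyTimeComputable` (file `TimeBounds.lean`) of `uncurry run` with
the pair presented through `boolPair` (file `BoolEncodings.lean`), together with a polynomial
coin budget. We also provide a per-input worst-case bound `RandAlg.RunsInTime` and the
expected-running-time hook `RandAlg.RunsInExpectedTime` (mean, over the `2^m` coin strings, of a
pointwise step bound), consumed by T-CRYPTO / pqc ("expected PPT", Las Vegas algorithms).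

At the level of *languages*, `uniformProb m E` is the probability that a uniformly random
string of length `m` lies in `E`; the class operators `bp`, `rp`, `pMajority`
(file `ProbabilisticClasses.lean`) are phrased with it.

Mathlib anchors used (not redefined): `PMF`, `PMF.uniformOfFintype`, `PMF.map`, `PMF.pure`,
`PMF.toOuterMeasure`, `PMF.toOuterMeasure_uniformOfFintype_apply`, and the instance
`Vector.fintype : Fintype (List.Vector α n)` (`Mathlib/Data/Fintype/Vector.lean`). Mathlib has
no notion of randomized algorithm / PPT machine.

## Design notes

* Universes `α β Γ₁ : Type` (Mathlib's TM2 API is `Type`-monomorphic).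
* `IsPolyTime` asks for polynomial time on **all** coin strings, not only on those of length
  `coinLen |x|`. This is equivalent up to truncation/padding of the coin string (the machine
  may count coins itself in polynomial time) and is Gill's "polynomial time on every input and
  every coin sequence".
* `RunsInTime`/`RunsInExpectedTime` bound the time on the machine input `boolPair (ea x) r`,
  so (halting rule of `TimeBounds.lean`) any admissible bound dominates `2|ea x| + 2 + coinLen`.
* `uniformProb` and `pr` are real-valued (via a classical `Finset.filter`, resp. `.toReal` of
  an outer measure) so that statements can write `2/3 ≤ …` in `ℝ`.

## References

* J. Gill, *Computational complexity of probabilistic Turing machines*, SIAM J. Comput. 6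
  (1977), §2 (probabilistic TMs, "polynomial time on every input and coin sequence"), §5 (ZPP).
* S. Arora, B. Barak, *Computational Complexity: A Modern Approach*, CUP 2009, §7.1
  (Def. 7.1, PTMs as deterministic TMs with a random tape; Def. 7.2/7.3 BPTIME/BPP; expected
  running time, Def. 7.7 area), §9.1 (PPT algorithms in cryptography).
* O. Goldreich, *Foundations of Cryptography I*, CUP 2001, §1.3.2 (probabilistic polynomial
  time; expected polynomial time).
-/

namespace Literature.Computability.Complexity

open Turing _root_.Computability

variable {α β Γ₁ : Type}

/-! ### Uniform probability on bit strings of a fixed length -/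

/-- `uniformProb m E`: the probability that a uniformly random bit string of length `m` lies in
the event `E ⊆ {0,1}*`, i.e. `#{r ∈ {0,1}^m | r ∈ E} / 2^m ∈ [0,1]` (as a real number; the
count is a classical `Finset.filter` over `List.Vector Bool m`).
[Arora–Barak 2009, Def. 7.1–7.3 (`Pr_{r ∈ {0,1}^m}`); Gill 1977, §2] [cite: AroraBarak2009, Def. 7.1–7.3] -/
noncomputable def uniformProb (m : ℕ) (E : Set (List Bool)) : ℝ :=
  open scoped Classical in
  ((Finset.univ.filter fun r : List.Vector Bool m => r.toList ∈ E).card : ℝ) / 2 ^ m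

/-- `uniformProb m E` is nonnegative. [Arora–Barak 2009, §7.1] [cite: AroraBarak2009, §7.1] -/
theorem uniformProb_nonneg (m : ℕ) (E : Set (List Bool)) : 0 ≤ uniformProb m E := by
  unfold uniformProb
  positivity

/-- `uniformProb m E` is at most `1` (there are `2^m` strings of length `m`).
[Arora–Barak 2009, §7.1; Mathlib `card_vector`] [cite: AroraBarak2009, §7.1] -/
theorem uniformProb_le_one (m : ℕ) (E : Set (List Bool)) : uniformProb m E ≤ 1 := by
  classical
  unfold uniformProb
  rw [div_le_one (by positivity)]
  have h := Finset.card_filter_le (Finset.univ : Finset (List.Vector Bool m))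
    (fun r => r.toList ∈ E)
  rw [Finset.card_univ, card_vector, Fintype.card_bool] at h
  exact_mod_cast h

/-- The empty event has probability `0`. [Arora–Barak 2009, §7.1] [cite: AroraBarak2009, §7.1] -/
@[simp] theorem uniformProb_empty (m : ℕ) : uniformProb m ∅ = 0 := by
  simp [uniformProb]

/-- The sure event has probability `1`. [Arora–Barak 2009, §7.1; Mathlib `card_vector`] [cite: AroraBarak2009, §7.1] -/
@[simp] theorem uniformProb_univ (m : ℕ) : uniformProb m Set.univ = 1 := by
  simp [uniformProb, card_vector]

/-- Link to Mathlib's uniform `PMF`: `uniformProb m E` is the (real value of the) outer measure,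
under `PMF.uniformOfFintype (List.Vector Bool m)`, of the pull-back of `E` along
`List.Vector.toList`. [Mathlib `PMF.toOuterMeasure_uniformOfFintype_apply`] [folklore] -/
theorem uniformProb_eq_toOuterMeasure (m : ℕ) (E : Set (List Bool)) :
    uniformProb m E =
      ((PMF.uniformOfFintype (List.Vector Bool m)).toOuterMeasure
        {r : List.Vector Bool m | r.toList ∈ E}).toReal := by
  classical
  unfold uniformProb
  rw [PMF.toOuterMeasure_uniformOfFintype_apply, card_vector, Fintype.card_bool,
    ENNReal.toReal_div]
  congr 1
  · rw [Fintype.card_ofFinset]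
    simp
  · simp

/-! ### Randomized algorithms -/

/-- A randomized algorithm from `α` to `β`, presented as a deterministic function of the input
and the coin string, `run : α → List Bool → β`, together with the coin budget `coinLen n` (the
number of random bits used on inputs of encoded length `n`). This is the "deterministic TM with
an auxiliary random tape" view of a probabilistic Turing machine.
[Arora–Barak 2009, Def. 7.1 and the remark after it; Goldreich 2001, §1.3.2] [cite: AroraBarak2009, Def. 7.1 and the remark after it] -/
structure RandAlg (α β : Type) where
  /-- The output on input `x` with coin string `r`. -/
  run : α → List Bool → β
  /-- The number of coins used on inputs of encoded length `n`. -/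
  coinLen : ℕ → ℕ

namespace RandAlg

/-- The output distribution of `A` on input `x` (w.r.t. the input encoder `ea`, which fixes the
input length and hence the number of coins): the push-forward under `r ↦ A.run x r` of the
uniform distribution on `{0,1}^{coinLen |ea x|}`.
[Arora–Barak 2009, §7.1 ("the random variable `M(x)`"); Mathlib `PMF.uniformOfFintype`,
`PMF.map`] [cite: AroraBarak2009, §7.1] -/
noncomputable def outputPMF (A : RandAlg α β) (ea : α → List Bool) (x : α) : PMF β :=
  (PMF.uniformOfFintype (List.Vector Bool (A.coinLen (ea x).length))).map
    fun r => A.run x r.toList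

/-- `A.pr ea x E`: the probability (a real number in `[0,1]`) that the output of `A` on input
`x` lies in the event `E ⊆ β`, over uniformly random coins of length `coinLen |ea x|`.
[Arora–Barak 2009, §7.1; Mathlib `PMF.toOuterMeasure`] [cite: AroraBarak2009, §7.1] -/
noncomputable def pr (A : RandAlg α β) (ea : α → List Bool) (x : α) (E : Set β) : ℝ :=
  ((A.outputPMF ea x).toOuterMeasure E).toReal

/-- `A.IsPolyTime ea eb`: `A` is a probabilistic polynomial-time (PPT) algorithm — the map
`(x, r) ↦ A.run x r`, with the pair presented as `boolPair (ea x) r`, is polynomial-time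
computable, and the coin budget `coinLen` is polynomially bounded.

Polynomial time is required on **all** coin strings `r`, not only on those of length
`coinLen |ea x|`. This is equivalent to the restricted requirement up to truncating/padding the
coin string (a polynomial-time preprocessing), and it is literally Gill's definition:
"polynomial time on every input and every coin sequence".
[Gill 1977, §2; Arora–Barak 2009, Def. 7.1–7.3; Goldreich 2001, §1.3.2 (PPT)] [cite: Gill1977, §2] -/
def IsPolyTime (A : RandAlg α β) (ea : α → List Bool) (eb : β → List Γ₁) : Prop :=
  PolyTimeComputable (fun p : α × List Bool => boolPair (ea p.1) p.2) eb
      (Function.uncurry A.run) ∧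
    ∃ p : Polynomial ℕ, ∀ n, A.coinLen n ≤ p.eval n

/-- `A.RunsInTime ea eb T`: per-input worst-case running time — some TM2 machine computes
`A.run x r` from `boolPair (ea x) r` within `T x` steps, for every input `x` and every coin
string `r` of the prescribed length `coinLen |ea x|`. By the halting rule (`TimeBounds.lean`),
an admissible `T x` dominates `2|ea x| + 2 + coinLen |ea x|`.
[Arora–Barak 2009, Def. 7.1 (`T(n)`-time PTM); H21 `ComputesInTime`] [cite: AroraBarak2009, Def. 7.1] -/
def RunsInTime (A : RandAlg α β) (ea : α → List Bool) (eb : β → List Γ₁) (T : α → ℕ) : Prop :=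
  ∃ M : TM2ComputableAux Bool Γ₁, ∀ x r, r.length = A.coinLen (ea x).length →
    M.OutputsWithin (boolPair (ea x) r) (eb (A.run x r)) (T x)

/-- `A.RunsInExpectedTime ea eb T`: expected running time at most `T x` on input `x` — some
TM2 machine computes `A.run x r` from `boolPair (ea x) r` within `τ x r` steps for every coin
string `r` of length `m = coinLen |ea x|`, and the mean of `τ x r` over the `2^m` coin strings
is at most `T x`. This is the hook for "expected polynomial time" and Las Vegas statements
(ZPP, expected-PPT simulators and extractors in cryptography).
[Gill 1977, §5 (ZPP); Goldreich 2001, §1.3.2 (expected polynomial time); Arora–Barak 2009,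
§7.1 (Def. 7.7, ZTIME via expected running time)] [cite: Gill1977, §5] -/
def RunsInExpectedTime (A : RandAlg α β) (ea : α → List Bool) (eb : β → List Γ₁)
    (T : α → ℝ) : Prop :=
  ∃ (M : TM2ComputableAux Bool Γ₁) (τ : α → List Bool → ℕ),
    (∀ x r, r.length = A.coinLen (ea x).length →
      M.OutputsWithin (boolPair (ea x) r) (eb (A.run x r)) (τ x r)) ∧
    ∀ x, (∑ r : List.Vector Bool (A.coinLen (ea x).length), (τ x r.toList : ℝ)) /
      2 ^ (A.coinLen (ea x).length) ≤ T x

/-- A deterministic function as a randomized algorithm using no coins (`coinLen = 0`, coins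
ignored). [Arora–Barak 2009, §7.1 (P ⊆ BPP)] [cite: AroraBarak2009, §7.1] -/
def ofDet (f : α → β) : RandAlg α β where
  run x _ := f x
  coinLen _ := 0

/-- `A.DecidesWithError L ε`: the Boolean-valued randomized algorithm `A` on bit strings
decides the language `L` with (two-sided) error probability at most `ε` on every input:
`Pr_r[A(x, r) = [x ∈ L]] ≥ 1 - ε`. With `ε = 1/3` and `A.IsPolyTime id encodeBool` this is
membership of `L` in BPP. [Arora–Barak 2009, Def. 7.2–7.3; Gill 1977, §2] [cite: AroraBarak2009, Def. 7.2–7.3] -/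
def DecidesWithError (A : RandAlg (List Bool) Bool) (L : Language Bool) (ε : ℝ) : Prop :=
  ∀ x, 1 - ε ≤ A.pr id x {b | b = true ↔ x ∈ L}

/-- The output distribution of a deterministic algorithm is the Dirac mass at `f x`.
[Mathlib `PMF.pure`, `PMF.map_const`] [folklore] -/
@[simp] theorem outputPMF_ofDet (f : α → β) (ea : α → List Bool) (x : α) :
    (ofDet f).outputPMF ea x = PMF.pure (f x) := by
  simp only [outputPMF, ofDet]
  exact PMF.map_const _ _

/-- The probability that a deterministic algorithm's output lies in `E` is the indicator of
`f x ∈ E`. [Mathlib `PMF.toOuterMeasure_pure_apply`] [folklore] -/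
theorem pr_ofDet (f : α → β) (ea : α → List Bool) (x : α) (E : Set β) [Decidable (f x ∈ E)] :
    (ofDet f).pr ea x E = if f x ∈ E then 1 else 0 := by
  rw [pr, outputPMF_ofDet, PMF.toOuterMeasure_pure_apply]
  split_ifs <;> simp [*]

/-- A polynomial-time computable deterministic function is a PPT algorithm (read `x` off the
first component of the pair, ignore the coins): `coinLen = 0` gives the polynomial coin bound,
and `uncurry (ofDet f).run = f ∘ Prod.fst` on the `boolPair` encoding. Named fact (D-0014): a
proof needs `PolyTimeComputable.comp` and `polyTimeComputable_fst` (both named facts upstream,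
Mathlib's open `proof_wanted TM2ComputableInPolyTime.comp`) plus a still-missing re-encoding
lemma transporting `polyTimeComputable_fst` from `List Bool × List Bool` (under
`uncurry boolPair`) to `α × List Bool` (under `p ↦ boolPair (ea p.1) p.2`). The types are bound
inside, so one witness `h : IsPolyTime.ofDet` serves every instantiation (`h hf`).
[Arora–Barak 2009, §7.1 (P ⊆ BPP)] [cite: AroraBarak2009, §7.1] -/
def IsPolyTime.ofDet : Prop :=
  ∀ {α β Γ₁ : Type} {f : α → β} {ea : α → List Bool} {eb : β → List Γ₁},
    PolyTimeComputable ea eb f → (RandAlg.ofDet f).IsPolyTime ea eb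

/-- A worst-case time bound is an expected time bound (take `τ x r := T x`; the mean of a
constant is the constant). [Arora–Barak 2009, §7.1] [cite: AroraBarak2009, §7.1] -/
theorem RunsInTime.runsInExpectedTime {A : RandAlg α β} {ea : α → List Bool}
    {eb : β → List Γ₁} {T : α → ℕ} (h : A.RunsInTime ea eb T) :
    A.RunsInExpectedTime ea eb fun x => (T x : ℝ) := by
  obtain ⟨M, hM⟩ := h
  refine ⟨M, fun x _ => T x, hM, fun x => ?_⟩
  rw [Finset.sum_const, Finset.card_univ, card_vector, Fintype.card_bool, nsmul_eq_mul]
  push_cast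
  rw [mul_div_cancel_left₀ _ (by positivity)]

end RandAlg

end Literature.Computability.Complexity
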